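/-
Copyright (c) 2026 the pub-hodgecm-mathlib formalisation cell (harness21).  Prover seat hodgecm-mathlib-K2Liu-p10 (g4), Track B «K2-LIT»,
#184♮ = hLiu418 = `stmt-HodgeConjecture-24832`; (σ) endgame organ, SMALL SIDE, S-2b: the Kudla–Rallis section `B Φ h := Λ(ω(h)Φ)` and its laws.  DEFS brick (1 def) + theorems.
-/
import Summits.HodgeConjecture.HodgeConjecture.Theorems.K2LiuKRFunctionalLevi   -- ★∕📤 S-2a p860777 (`krFun_zero_leviOp`, `krMap_zero_levi`, `krFun_zero_of_phase_one`)
import HarnessLib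

/-!
# Crux `HLiu418`, (σ) small side, S-2b: THE KUDLA–RALLIS SECTION `B Φ (h) := (r(ω(h)Φ))(0)` — DEFINITION, EQUIVARIANCE, LEVI LAW, UNIPOTENT LAW

Cell `hodgecm-mathlib`, crux item hLiu418 = `stmt-HodgeConjecture-24832`, route of record `HCCMUnconditional`; squad K2 ∕ K2Liu, prover K2Liu-p10 (g4).
ONE DEFINITION WITH BODY (`krSection`) + theorems; no instance, no notation, no named fact, no `sorry`; definition lane, `--supports stmt-HodgeConjecture-24832 --as helper`.
Generic: `F` a second-countable locally compact Borel field, frame `θ : X ≃ₜ ((β ⊕ γ) ⊕ α → F)`, Haar `μ` on `F^α`, an operator family `ω : H → 𝒮(X) →ₗ 𝒮(X)`.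

V8e's small-side binders (`face_two_of_laws`: `B`, `hB`, and the two halves of `hSiegS`) in the DIRECT form of my census 13:57Z (q2)-(d):
* §1 **`krSection θ μ ω : 𝒮(X) →ₗ[ℂ] (H → ℂ)`**, `Φ ↦ (h ↦ (krMap θ μ (ω h Φ)) 0)`; `krSection_apply`;
* §2 **`krSection_mul`** (= V8e's `hB`): if `ω (h * u) = ω h ∘ ω u` then `B (ω u Φ) h = B Φ (h * u)`;
* §3 **`krSection_levi_mul`**: under the Levi law `ω (m a) Φ = c_M(a) • leviEquivSB (aX a) Φ` with slice matrices `D a` (★ S-2a `hS0`),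
  `B Φ (m a * h) = c_M(a) · mod_F(det D a)⁻¹ · B Φ h`; **`krSection_unip_mul`**: under `ω (n η) Φ x = ψ(η ⬝ q x) Φ x` (V8e's `hN`) and `q = 0` on the slice `u = 0`
  (`hq0`, isotropy of the integrated block), `B Φ (n η * h) = B Φ h`.
With ★ (L3-a)∕(L3-b) and the instance Jacobian letter these give `IsLocalSiegelSection χv′ (−½) (B Φ)` at the CM instance (S-2c, on p09's `ω := toRep ∘ sΔB`).

HONEST LABEL: HC_CM is proved only modulo the 7 printed citations (2 remaining named inputs: hLiu418 = stmt-HodgeConjecture-24832, h413 = stmt-HodgeConjecture-24833)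
until rung 0 closes; this file defines one carrier map and closes no item.
References: [KudlaRallis1994] §1; [HarrisKudlaSweet1996] §4 (the sections `Φ ↦ ω(h)Φ` restricted along the mixed model); [Kudla1994] §3.
-/

set_option autoImplicit false
set_option linter.dupNamespace false -- the mandated namespace repeats `HodgeConjecture.HodgeConjecture`

noncomputable section

open MeasureTheory
open scoped ENNReal NNReal Matrix
open Literature.NumberTheory.Automorphic
open Literature.RepresentationTheory.HeisenbergGroup
open Summit.HodgeConjecture.HodgeConjecture.Cruxes.HLiu418.K2LiuKudlaRallisMapDefs
open Summit.HodgeConjecture.HodgeConjecture.Cruxes.HLiu418.K2LiuKRFunctionalLevi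

namespace Summit.HodgeConjecture.HodgeConjecture.Cruxes.HLiu418.K2LiuKRSectionDefs

variable {F : Type*} [Field F] [TopologicalSpace F] [IsTopologicalRing F] [LocallyCompactSpace F]
  [SecondCountableTopology F] [MeasurableSpace F] [BorelSpace F] [T2Space F]
  {α : Type*} [Fintype α] [DecidableEq α]
  {X : Type*} [AddCommGroup X] [TopologicalSpace X] {β γ : Type*}
  (θ : X ≃ₜ ((β ⊕ γ) ⊕ α → F)) (μ : Measure (α → F)) [μ.IsAddHaarMeasure]
  {H : Type*} (ω : H → SchwartzBruhat X →ₗ[ℂ] SchwartzBruhat X)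

/-! ## §1 The section -/

/-- **THE KUDLA–RALLIS SECTION `B Φ (h) := (r(ω(h)Φ))(0) = ∫_{F^α} (ω(h)Φ)(θ⁻¹((0 ⊔ 0) ⊔ t)) dμ(t)`** — V8e's small-side `B` in the direct form.
[cite: KudlaRallis1994, §1] [cite: HarrisKudlaSweet1996, §4] -/
def krSection : SchwartzBruhat X →ₗ[ℂ] (H → ℂ) where
  toFun Φ h := ((krMap θ μ (ω h Φ) : SchwartzBruhat (β → F)) : (β → F) → ℂ) 0
  map_add' Φ Ψ := funext fun h => by
    simp only [map_add, Submodule.coe_add, Pi.add_apply]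
  map_smul' c Φ := funext fun h => by
    simp only [map_smul, Submodule.coe_smul, Pi.smul_apply, RingHom.id_apply]

omit [IsTopologicalRing F] [LocallyCompactSpace F] [DecidableEq α] [AddCommGroup X] in
/-- unfolding. [cite: KudlaRallis1994, §1] -/
theorem krSection_apply (Φ : SchwartzBruhat X) (h : H) : krSection θ μ ω Φ h = ((krMap θ μ (ω h Φ) : SchwartzBruhat (β → F)) : (β → F) → ℂ) 0 :=
  rfl

omit [IsTopologicalRing F] [LocallyCompactSpace F] [DecidableEq α] [AddCommGroup X] in
/-- unfolding as an integral. [cite: KudlaRallis1994, §1] -/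
theorem krSection_eq_integral (Φ : SchwartzBruhat X) (h : H) :
    krSection θ μ ω Φ h = ∫ t, ((ω h Φ : SchwartzBruhat X) : X → ℂ) (θ.symm (Sum.elim (Sum.elim 0 0) t)) ∂μ :=
  rfl

/-! ## §2 Equivariance (V8e's `hB`) -/

omit [IsTopologicalRing F] [LocallyCompactSpace F] [DecidableEq α] [AddCommGroup X] in
/-- **`B (ω u Φ) h = B Φ (h u)`** when `ω` is multiplicative. [cite: HarrisKudlaSweet1996, §4] -/
theorem krSection_mul [Mul H] (hω : ∀ (h u : H) (Φ : SchwartzBruhat X), ω (h * u) Φ = ω h (ω u Φ)) (u : H) (Φ : SchwartzBruhat X) (h : H) :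
    krSection θ μ ω (ω u Φ) h = krSection θ μ ω Φ (h * u) := by
  rw [krSection_apply, krSection_apply, hω]

/-! ## §3 The Levi and unipotent laws (the two halves of V8e's `hSiegS`) -/

/-- **LEVI LAW `B Φ (m a · h) = c_M(a) · mod_F(det D_a)⁻¹ · B Φ h`**. [cite: KudlaRallis1994, §1] [cite: Kudla1994, §3] -/
theorem krSection_levi_mul [Mul H] (hω : ∀ (h u : H) (Φ : SchwartzBruhat X), ω (h * u) Φ = ω h (ω u Φ))
    {R : Type*} [CommRing R] [Module R X] {Γ₁ : Type*} (mΔ : Γ₁ → H) (aX : Γ₁ → (X ≃ₗ[R] X))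
    (haXc : ∀ a, Continuous (aX a)) (haXc' : ∀ a, Continuous (aX a).symm) (cM : Γ₁ → ℂ)
    (hM : ∀ (a : Γ₁) (Φ : SchwartzBruhat X), ω (mΔ a) Φ = cM a • leviEquivSB (aX a) (haXc a) (haXc' a) Φ)
    (D : Γ₁ → Matrix α α F) (hD : ∀ a, (D a).det ≠ 0)
    (hS0 : ∀ (a : Γ₁) (t : α → F), θ ((aX a).symm (θ.symm (Sum.elim (Sum.elim (0 : β → F) (0 : γ → F)) t))) = Sum.elim (Sum.elim (0 : β → F) (0 : γ → F)) (D a *ᵥ t))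
    (Φ : SchwartzBruhat X) (a : Γ₁) (h : H) :
    krSection θ μ ω Φ (mΔ a * h) = cM a * (((distribHaarChar F (Units.mk0 (D a).det (hD a)))⁻¹ : ℝ≥0) • krSection θ μ ω Φ h) := by
  rw [krSection_apply, krSection_apply, hω, krMap_zero_levi θ μ ω mΔ aX haXc haXc' cM hM D hD hS0]

omit [IsTopologicalRing F] [LocallyCompactSpace F] [DecidableEq α] [AddCommGroup X] in
/-- **UNIPOTENT LAW `B Φ (n η · h) = B Φ h`**: the phase `ψ(η ⬝ q x)` is `1` on the slice because the integrated block is isotropic (`q = 0` there).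
[cite: KudlaRallis1994, §1] [cite: Kudla1994, §3] -/
theorem krSection_unip_mul [Mul H] (hω : ∀ (h u : H) (Φ : SchwartzBruhat X), ω (h * u) Φ = ω h (ω u Φ))
    {ι : Type*} [Fintype ι] (nΔ : (ι → F) → H) (q : X → ι → F) (e : F → ℂ) (he : e 0 = 1)
    (hN : ∀ (η : ι → F) (Φ : SchwartzBruhat X) (x : X), ((ω (nΔ η) Φ : SchwartzBruhat X) : X → ℂ) x = e (η ⬝ᵥ q x) * (Φ : X → ℂ) x)
    (hq0 : ∀ t : α → F, q (θ.symm (Sum.elim (Sum.elim (0 : β → F) (0 : γ → F)) t)) = 0)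
    (Φ : SchwartzBruhat X) (η : ι → F) (h : H) :
    krSection θ μ ω Φ (nΔ η * h) = krSection θ μ ω Φ h := by
  rw [krSection_eq_integral, krSection_eq_integral, hω]
  refine integral_congr_ae (Filter.Eventually.of_forall fun t => ?_)
  simp only [hN, hq0 t, dotProduct_zero, he, one_mul]

end Summit.HodgeConjecture.HodgeConjecture.Cruxes.HLiu418.K2LiuKRSectionDefs

end
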